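import Summits.Schanuel.Schanuel.Theorems.ZilberEacRealHyperplaneDensity
import HarnessLib

/-!
# Zariski density in the MIXED fast/slow regime over real hyperplanes (THEOREM R⁺⁺ families):
# more 3-folds of `EC(3,2)` with dense exponential points

Zilber's Exponential-Algebraic Closedness, case ladder (host summit Schanuel, cell `pub-schanuel`,
seat 2, gen 9).  `ZilberEacRealHyperplaneDensity` proved the Zariski density of the exponential points
of the `(s+2)`-folds `W = polyFibredGraph (Σ rᵢXᵢ + c) A (Fⱼ(u))` in the SLOW regime of THEOREM R⁺.
Here the same is done in the MIXED regime of THEOREM R⁺⁺ (`ZilberEacRealHyperplaneFast`: fibre `0`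
fast, `e = 1 + deg F₀`, transformed data `Â = fastData r c A F`, solutions `x = fastBack z` with `z`
near the lattice centres of the `z`-system):

**THEOREM (`unprojectedDense_polyFibredGraph_hyperplane_mixed`).**  Under the hypotheses of THEOREM
R⁺⁺ for all admissible rays (`Âⱼ ≠ 0`, `d̂₀ ≥ 1`, (i) `ν := (d̂₀/e - Σ_{i≥1} rᵢ d̂ᵢ)/r₀ < d̂₀`,
(ii) `d̂₀(1 + deg Fⱼ) < e d̂ⱼ`), if moreover `ν` is IRRATIONAL then `I(W ∩ Γ_exp) = I(W)`.

Proof: THEOREM J (`ZilberEacDirectionalDominance`) with direction coordinates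
`(x_{s+1}, x₁, …, x_s) = (z₀/e, z₁, …, z_s) = m (2πi q₀/e, 2πi q₁, …) + O(log m)` and power
coordinate `y₀ = e^{x₀}`, `log |y₀| = Re x₀ = ν log m + O(1)` (`re_fastBack_zero` and the lattice-centre
control of `Â`); the scaled lattice directions off the hypersurface of bad rays are Zariski dense
(`scaledLatticeDirections_dense`).

Corollaries: the diagonal 3-folds `{x₂ = r₀x₀ + r₁x₁ + c, y₀ = x₀ + y₂F₀(y₂), y₁ = x₁ + y₂F₁(y₂)}`
(`unprojectedDense_mixed_diag`: `r₀ ≠ 0 ≠ r₁`, `F₀ ≠ 0`, `F₁ = 0 ∨ deg F₁ < deg F₀`,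
`ν = (1/(1 + deg F₀) - r₁)/r₀ < 1` irrational), and the certified member of `EC(3,2)`
`W₂₃ = {x₂ = √2x₀ + √3x₁, y₀ = x₀ + y₂², y₁ = x₁ + y₂}` of `ZilberEacRealHyperplaneCell`
(`sqrtTwoSqrtThreeMixed`, solved in gen 8): its exponential points are ZARISKI DENSE
(`unprojectedDense_sqrtTwoSqrtThreeMixed`; `ν = (1/2 - √3)/√2 ∉ ℚ`).

HONEST FRAMING: explicit families inside an OPEN cell; existence was THEOREM R⁺⁺ (gen 8), NEW is the
Zariski density; `EC(3,2)` itself OPEN; NOT Schanuel's conjecture; EAC ⇏ SC.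
-/

noncomputable section

open Complex MvPolynomial Filter Topology
open Literature.NumberTheory.Transcendental Literature.ModelTheory.Zilber
  Literature.ModelTheory.ExponentialFields

set_option linter.dupNamespace false

namespace Summit.Schanuel.Schanuel.Theorems

/-! ## Scaled lattice directions -/

section Scaling

variable {t : ℕ}

/-- Scaling the variables by nonzero constants `κᵢ` is injective on `ℂ[X₁..X_t]`. [folklore] -/
theorem bind₁_scaleVec_ne_zero {G : MvPolynomial (Fin t) ℂ} (hG : G ≠ 0) {κ : Fin t → ℂ}
    (hκ : ∀ i, κ i ≠ 0) : bind₁ (fun i => C (κ i) * X i) G ≠ 0 := by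
  intro h
  apply hG
  have hcomp : bind₁ (fun i => C (κ i)⁻¹ * X i) (bind₁ (fun i => C (κ i) * X i) G) = G := by
    rw [bind₁_bind₁]
    have : (fun i => bind₁ (fun i => C (κ i)⁻¹ * X i) (C (κ i) * X i : MvPolynomial (Fin t) ℂ)) = X := by
      funext i
      rw [map_mul, bind₁_C_right, bind₁_X_right, ← mul_assoc, ← map_mul, mul_inv_cancel₀ (hκ i),
        map_one, one_mul]
    rw [this, bind₁_X_left, AlgHom.id_apply]
  rw [← hcomp, h, map_zero]

/-- **Scaled lattice directions are Zariski dense**: for `L ≠ 0`, `a ≠ 0`, `κᵢ ≠ 0`, every nonzero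
`G` is non-vanishing at some `(κᵢ a qᵢ)ᵢ` with `q ∈ ℤ^t` and `L(a q) ≠ 0`. [folklore] -/
theorem scaledLatticeDirections_dense {L : MvPolynomial (Fin t) ℂ} (hL : L ≠ 0) {a : ℂ} (ha : a ≠ 0)
    {κ : Fin t → ℂ} (hκ : ∀ i, κ i ≠ 0) (G : MvPolynomial (Fin t) ℂ) (hG : G ≠ 0) :
    ∃ v ∈ {v : Fin t → ℂ | (∃ q : Fin t → ℤ, (v = fun i => κ i * (a * (q i : ℂ))) ∧
      eval (fun i => a * (q i : ℂ)) L ≠ 0)}, eval v G ≠ 0 := by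
  have hG' := bind₁_scaleVec_ne_zero hG hκ
  obtain ⟨q, hq⟩ := exists_int_eval_ne_zero (mul_ne_zero hL hG') ha
  rw [map_mul] at hq
  refine ⟨fun i => κ i * (a * (q i : ℂ)), ⟨q, rfl, left_ne_zero_of_mul hq⟩, ?_⟩
  have h2 := right_ne_zero_of_mul hq
  change eval₂Hom (RingHom.id ℂ) (fun i => a * (q i : ℂ)) (bind₁ (fun i => C (κ i) * X i) G) ≠ 0 at h2
  rw [eval₂Hom_bind₁] at h2
  have hfun : (fun i => eval₂Hom (RingHom.id ℂ) (fun i => a * (q i : ℂ))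
      (C (κ i) * X i : MvPolynomial (Fin t) ℂ)) = fun i => κ i * (a * (q i : ℂ)) := by
    funext i; simp
  rwa [hfun] at h2

end Scaling

/-! ## Density in the mixed regime -/

section Mixed

variable {s : ℕ}

/-- **THEOREM (Zariski density over real hyperplanes, mixed fast/slow regime).**  See the module
docstring. (new) [cite: MantovaMasser2023, §1 p.5 (the open case dim π(V) = 2 in ℂ³×ℂˣ³)] -/
theorem unprojectedDense_polyFibredGraph_hyperplane_mixed (r : Fin (s + 1) → ℝ) (hr : r 0 ≠ 0)
    (c : ℂ) (A : Fin (s + 1) → MvPolynomial (Fin (s + 1)) ℂ) (F : Fin (s + 1) → Polynomial ℂ)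
    (hF : F 0 ≠ 0) (hAh : ∀ j, fastData r c A F j ≠ 0) (hd0 : 0 < (fastData r c A F 0).totalDegree)
    (hν : (((fastData r c A F 0).totalDegree : ℝ) / ((F 0).natDegree + 1) -
        ∑ i : Fin s, r i.succ * (fastData r c A F i.succ).totalDegree) / r 0 <
      (fastData r c A F 0).totalDegree)
    (hfast : ∀ i : Fin s, F i.succ ≠ 0 →
      ((fastData r c A F 0).totalDegree : ℝ) * ((F i.succ).natDegree + 1) <
        ((F 0).natDegree + 1) * (fastData r c A F i.succ).totalDegree)
    (hirr : Irrational ((((fastData r c A F 0).totalDegree : ℝ) / ((F 0).natDegree + 1) -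
        ∑ i : Fin s, r i.succ * (fastData r c A F i.succ).totalDegree) / r 0)) :
    UnprojectedDense (polyFibredGraph (hyperplanePoly r c) A (fun j => (F j).toMvPolynomial 0)) := by
  classical
  set Ah := fastData r c A F with hAhdef
  set e : ℕ := (F 0).natDegree + 1 with he
  have he0 : (e : ℂ) ≠ 0 := by exact_mod_cast (show e ≠ 0 by positivity)
  set ν : ℝ := (((Ah 0).totalDegree : ℝ) / ((F 0).natDegree + 1) -
    ∑ i : Fin s, r i.succ * (Ah i.succ).totalDegree) / r 0 with hνdef
  -- admissible rays and the scaling `κ = (1/e, 1, …, 1)`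
  set L : MvPolynomial (Fin (s + 1)) ℂ := ∏ j, homogeneousComponent (Ah j).totalDegree (Ah j) with hL
  have hL0 : L ≠ 0 := Finset.prod_ne_zero_iff.2 fun j _ =>
    ExpDominant.homogeneousComponent_totalDegree_ne_zero (hAh j)
  have h2pi : (2 * Real.pi * I : ℂ) ≠ 0 := Complex.two_pi_I_ne_zero
  set κ : Fin (s + 1) → ℂ := Fin.cons ((e : ℂ)⁻¹) (fun _ => 1) with hκ
  have hκ0 : ∀ i, κ i ≠ 0 := fun i => by
    refine Fin.cases ?_ (fun j => ?_) i
    · simp only [hκ, Fin.cons_zero]; exact inv_ne_zero he0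
    · simp [hκ]
  have hκle : ∀ i, ‖κ i‖ ≤ 1 := fun i => by
    refine Fin.cases ?_ (fun j => ?_) i
    · simp only [hκ, Fin.cons_zero, norm_inv, Complex.norm_natCast]
      exact inv_le_one_of_one_le₀ (by rw [he]; exact_mod_cast Nat.succ_le_succ (Nat.zero_le _))
    · simp [hκ]
  refine unprojectedDense_of_directional_growth (t := s + 1) (isIrreducibleClosed_polyFibredGraph _ _ _)
    (by rw [zariskiDim_polyFibredGraph])
    (Fin.cons (Sum.inl (Fin.last (s + 1))) (fun i : Fin s => Sum.inl (Fin.castSucc i.succ)))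
    (Sum.inr (Fin.castSucc 0)) hirr
    (Q := {v : Fin (s + 1) → ℂ | (∃ q : Fin (s + 1) → ℤ,
      (v = fun i => κ i * (2 * Real.pi * I * (q i : ℂ))) ∧
        eval (fun i => 2 * Real.pi * I * (q i : ℂ)) L ≠ 0)})
    (fun G hG => scaledLatticeDirections_dense hL0 h2pi hκ0 G hG) ?_
  rintro v ⟨q, rfl, hvL⟩
  have hA : ∀ j, eval (fun i => 2 * Real.pi * I * (q i : ℂ))
      (homogeneousComponent (Ah j).totalDegree (Ah j)) ≠ 0 := by
    rw [hL, map_prod] at hvL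
    exact fun j => (Finset.prod_ne_zero_iff.1 hvL) j (Finset.mem_univ j)
  -- THEOREM R⁺⁺ along the ray, and a choice of solutions
  have hsol := exists_expPoint_realHyperplane_mixed r hr c q A F hF hA hd0 hν hfast
  set good : ℕ → (Fin (s + 1) → ℂ) → Prop := fun m z =>
    ‖z - fun i => (m : ℂ) * (2 * Real.pi * I * (q i : ℂ)) +
        log (eval (fun k => (m : ℂ) * (2 * Real.pi * I * (q k : ℂ))) (Ah i))‖ ≤ 1 / 2 ∧
      ∀ j, exp (fastBack r c e z j) = eval (fastBack r c e z) (A j) +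
        exp (ell r c (fastBack r c e z)) * (F j).eval (exp (ell r c (fastBack r c e z))) with hgood
  set zs : ℕ → Fin (s + 1) → ℂ := fun m => Classical.epsilon (good m) with hzs
  have hzs : ∀ᶠ m : ℕ in atTop, good m (zs m) := by
    filter_upwards [hsol] with m hm
    exact Classical.epsilon_spec hm
  set xs : ℕ → Fin (s + 1) → ℂ := fun m => fastBack r c e (zs m) with hxs
  set p : ℕ → Fin (s + 2) ⊕ Fin (s + 2) → ℂ := fun m =>
    pgParam (hyperplanePoly r c) A (fun j => (F j).toMvPolynomial 0) (xs m)
      (exp (∑ i, (r i : ℂ) * xs m i + c)) with hp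
  obtain ⟨K, hK0, hK⟩ := latticeCentre_control_of_leadingForm Ah _ (fun i => re_two_pi_I_mul_int (q i)) hA
  have hsolx : ∀ᶠ m : ℕ in atTop, ∀ j, exp (xs m j) = eval (xs m) (A j) +
      exp (∑ i, (r i : ℂ) * xs m i + c) * (F j).eval (exp (∑ i, (r i : ℂ) * xs m i + c)) := by
    filter_upwards [hzs] with m hm j
    exact hm.2 j
  refine ⟨p, ?_, ⟨K, ?_⟩, ⟨((K / e + (∑ i : Fin s, |r i.succ|) * K) + ‖c‖) / |r 0|, ?_⟩⟩
  · -- points of `W ∩ Γ_exp`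
    filter_upwards [hsolx] with m hm
    exact ⟨pgParam_mem _ _ _ _ _, pgParam_hyperplane_mem_expGraph r c A F hm⟩
  · -- direction coordinates `(x_{s+1}, x₁..x_s) = κ • z = m v + O(log m)`
    filter_upwards [hzs, hK] with m hm hKm
    have hz := (hKm (zs m) hm.1).1
    have hcoord : (fun i => p m ((Fin.cons (Sum.inl (Fin.last (s + 1)))
        (fun i : Fin s => Sum.inl (Fin.castSucc i.succ)) : Fin (s + 1) → _) i)) =
        fun i => κ i * zs m i := by
      funext i
      refine Fin.cases ?_ (fun j => ?_) i
      · simp only [Fin.cons_zero, hp, pgParam_inl_last, eval_hyperplanePoly, hxs, ell_fastBack hr, hκ]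
        rw [div_eq_inv_mul]
      · simp only [Fin.cons_succ, hp, pgParam_inl_castSucc, hxs, fastBack_succ, hκ, one_mul]
    rw [hcoord]
    have hdiff : (fun i => κ i * zs m i) - (fun i => (m : ℂ) * (κ i * (2 * Real.pi * I * (q i : ℂ)))) =
        fun i => κ i * ((zs m - fun i => (m : ℂ) * (2 * Real.pi * I * (q i : ℂ))) i) := by
      funext i; simp only [Pi.sub_apply]; ring
    rw [hdiff]
    refine le_trans ?_ hz
    refine (pi_norm_le_iff_of_nonneg (norm_nonneg _)).2 fun i => ?_
    rw [norm_mul]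
    calc ‖κ i‖ * ‖(zs m - fun i => (m : ℂ) * (2 * Real.pi * I * (q i : ℂ))) i‖
        ≤ 1 * ‖(zs m - fun i => (m : ℂ) * (2 * Real.pi * I * (q i : ℂ))) i‖ :=
          mul_le_mul_of_nonneg_right (hκle i) (norm_nonneg _)
      _ = ‖(zs m - fun i => (m : ℂ) * (2 * Real.pi * I * (q i : ℂ))) i‖ := one_mul _
      _ ≤ _ := norm_le_pi_norm _ i
  · -- power coordinate `y₀ = e^{x₀}`, `Re x₀ = ν log m + O(1)`
    filter_upwards [hzs, hK, hsolx] with m hm hKm hmx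
    have hre := (hKm (zs m) hm.1).2
    have hβ : p m (Sum.inr (Fin.castSucc 0)) = exp (xs m 0) := by
      simp only [hp, pgParam_inr, pMulParam_castSucc, MvPolynomial.eval_toMvPolynomial, Fin.cons_zero]
      exact (hmx 0).symm
    rw [hβ, Complex.norm_exp, Real.log_exp]
    refine ⟨Complex.exp_ne_zero _, ?_⟩
    have hx0 : (xs m 0).re = (((zs m 0).re / e - ∑ i : Fin s, r i.succ * (zs m i.succ).re - c.re)) / r 0 :=
      re_fastBack_zero r c e (zs m)
    -- the deviation
    have hdev : (xs m 0).re - ν * Real.log m =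
        (((zs m 0).re - (Ah 0).totalDegree * Real.log m) / e -
          ∑ i : Fin s, r i.succ * ((zs m i.succ).re - (Ah i.succ).totalDegree * Real.log m) - c.re) / r 0 := by
      rw [hx0, hνdef, he]
      push_cast
      have hsum : ∑ i : Fin s, r i.succ * ((zs m i.succ).re - (Ah i.succ).totalDegree * Real.log m) =
          (∑ i : Fin s, r i.succ * (zs m i.succ).re) -
            (∑ i : Fin s, r i.succ * ((Ah i.succ).totalDegree : ℝ)) * Real.log m := by
        rw [Finset.sum_mul, ← Finset.sum_sub_distrib]
        exact Finset.sum_congr rfl fun i _ => by ring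
      rw [hsum]
      field_simp
      ring
    rw [hdev, abs_div]
    refine div_le_div_of_nonneg_right ?_ (abs_nonneg _)
    have h0 : |((zs m 0).re - (Ah 0).totalDegree * Real.log m) / e| ≤ K / e := by
      rw [abs_div, Nat.abs_cast]
      exact div_le_div_of_nonneg_right (hre 0) (by positivity)
    have h1 : |∑ i : Fin s, r i.succ * ((zs m i.succ).re - (Ah i.succ).totalDegree * Real.log m)| ≤
        (∑ i : Fin s, |r i.succ|) * K := by
      rw [Finset.sum_mul]
      refine (Finset.abs_sum_le_sum_abs _ _).trans (Finset.sum_le_sum fun i _ => ?_)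
      rw [abs_mul]
      exact mul_le_mul_of_nonneg_left (hre i.succ) (abs_nonneg _)
    have h2 : |c.re| ≤ ‖c‖ := Complex.abs_re_le_norm c
    calc |((zs m 0).re - (Ah 0).totalDegree * Real.log m) / e -
          ∑ i : Fin s, r i.succ * ((zs m i.succ).re - (Ah i.succ).totalDegree * Real.log m) - c.re|
        ≤ |((zs m 0).re - (Ah 0).totalDegree * Real.log m) / e -
            ∑ i : Fin s, r i.succ * ((zs m i.succ).re - (Ah i.succ).totalDegree * Real.log m)| + |c.re| :=
          abs_sub _ _
      _ ≤ (|((zs m 0).re - (Ah 0).totalDegree * Real.log m) / e| +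
            |∑ i : Fin s, r i.succ * ((zs m i.succ).re - (Ah i.succ).totalDegree * Real.log m)|) + |c.re| :=
          add_le_add (abs_sub _ _) le_rfl
      _ ≤ (K / e + (∑ i : Fin s, |r i.succ|) * K) + ‖c‖ := add_le_add (add_le_add h0 h1) h2

end Mixed

/-! ## Diagonal 3-folds and the `√2, √3` member of `EC(3,2)` -/

section Diag

/-- `(1 - 2√3)/(2√2)`… more precisely `(1/2 - √3)/√2` is irrational: else `√3` would be rational.
[folklore] -/
theorem irrational_half_sub_sqrt_three_div_sqrt_two :
    Irrational (((1 : ℝ) / 2 - Real.sqrt 3) / Real.sqrt 2) := by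
  rintro ⟨ρ, hρ⟩
  have h2 : Real.sqrt 2 * Real.sqrt 2 = 2 := Real.mul_self_sqrt (by norm_num)
  have h3 : Real.sqrt 3 * Real.sqrt 3 = 3 := Real.mul_self_sqrt (by norm_num)
  have h2pos : 0 < Real.sqrt 2 := Real.sqrt_pos.2 (by norm_num)
  have hmul : (ρ : ℝ) * Real.sqrt 2 = 1 / 2 - Real.sqrt 3 := by
    rw [hρ, div_mul_cancel₀ _ h2pos.ne']
  -- square: `2ρ² = 1/4 - √3 + 3`, so `√3` is rational
  have hsq : (ρ : ℝ) ^ 2 * 2 = 13 / 4 - Real.sqrt 3 := by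
    have hsq' : ((ρ : ℝ) * Real.sqrt 2) * ((ρ : ℝ) * Real.sqrt 2) =
        (1 / 2 - Real.sqrt 3) * (1 / 2 - Real.sqrt 3) := by rw [hmul]
    nlinarith [hsq', h2, h3]
  have hrat : Real.sqrt 3 = ((13 / 4 - ρ ^ 2 * 2 : ℚ) : ℝ) := by
    push_cast
    linarith
  exact (Nat.prime_three.irrational_sqrt) ⟨_, hrat.symm⟩

/-- **Diagonal 3-folds, mixed regime: dense.**  `{x₂ = r₀x₀ + r₁x₁ + c, y₀ = x₀ + y₂F₀(y₂),
y₁ = x₁ + y₂F₁(y₂)}` with `r₀ ≠ 0 ≠ r₁`, `F₀ ≠ 0`, `F₁ = 0 ∨ deg F₁ < deg F₀`, and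
`ν = (1/(1 + deg F₀) - r₁)/r₀ < 1` IRRATIONAL: the exponential points (solutions of
`e^{z} = z + e^{ℓ}F₀(e^{ℓ})`, `e^{w} = w + e^{ℓ}F₁(e^{ℓ})`, `ℓ = r₀z + r₁w + c`) are Zariski dense.
(new) [cite: MantovaMasser2023, §1 p.5 (the open case dim π(V) = 2 in ℂ³×ℂˣ³)] -/
theorem unprojectedDense_mixed_diag {r₀ r₁ : ℝ} (hr₀ : r₀ ≠ 0) (hr₁ : r₁ ≠ 0) (c : ℂ)
    {F₀ : Polynomial ℂ} (hF₀ : F₀ ≠ 0) (F₁ : Polynomial ℂ) (hdeg : F₁ = 0 ∨ F₁.natDegree < F₀.natDegree)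
    (hν : ((1 : ℝ) / (F₀.natDegree + 1) - r₁) / r₀ < 1)
    (hirr : Irrational (((1 : ℝ) / (F₀.natDegree + 1) - r₁) / r₀)) :
    UnprojectedDense (polyFibredGraph (hyperplanePoly ![r₀, r₁] c) (fun j => X j)
      (fun j => ((![F₀, F₁] : Fin 2 → Polynomial ℂ) j).toMvPolynomial 0)) := by
  classical
  set r : Fin 2 → ℝ := ![r₀, r₁] with hr
  set A : Fin 2 → MvPolynomial (Fin 2) ℂ := fun j => X j with hAdef
  set F : Fin 2 → Polynomial ℂ := ![F₀, F₁] with hFdef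
  have hr0 : r 0 = r₀ := rfl
  have hr1 : r 1 = r₁ := rfl
  have hF0 : F 0 = F₀ := rfl
  have hF1 : F 1 = F₁ := rfl
  set e : ℕ := F₀.natDegree + 1 with he
  set c₀ : ℂ := F₀.leadingCoeff with hc₀
  have hc0 : c₀ ≠ 0 := Polynomial.leadingCoeff_ne_zero.2 hF₀
  have he0 : (e : ℂ) ≠ 0 := by exact_mod_cast (show e ≠ 0 by positivity)
  have hr0' : (r₀ : ℂ) ≠ 0 := by exact_mod_cast hr₀
  -- the transformed polynomials (as in `exists_expPoint_mixed_diag`)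
  set l : Fin 2 → ℂ := ![-c₀⁻¹ * ((r₀ : ℂ)⁻¹ * (e : ℂ)⁻¹), c₀⁻¹ * ((r₀ : ℂ)⁻¹ * (r₁ : ℂ))] with hl
  have hA0 : fastData r c A F 0 = ∑ i, C (l i) * X i + C (c₀⁻¹ * ((r₀ : ℂ)⁻¹ * c)) := by
    rw [fastData_zero, hAdef]
    simp only [aeval_X, fastSubst, Fin.cons_zero, hF0, Fin.sum_univ_one]
    rw [show (Fin.succ (0 : Fin 1) : Fin 2) = 1 from rfl, hr0, hr1]
    simp only [Fin.sum_univ_two, hl, Matrix.cons_val_zero, Matrix.cons_val_one, map_neg, map_mul, ← hc₀,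
      ← he]
    ring
  have hA1 : fastData r c A F 1 = X 1 := by
    rw [show (1 : Fin 2) = Fin.succ (0 : Fin 1) from rfl, fastData_succ, hAdef]
    simp only [aeval_X, fastSubst, Fin.cons_succ]
  have hl1 : l 1 ≠ 0 := by
    simp only [hl, Matrix.cons_val_one, Matrix.cons_val_fin_one]
    have : (r₁ : ℂ) ≠ 0 := by exact_mod_cast hr₁
    exact mul_ne_zero (inv_ne_zero hc0) (mul_ne_zero (inv_ne_zero hr0') this)
  have hdeg0 : (fastData r c A F 0).totalDegree = 1 := by
    rw [hA0]; exact totalDegree_linearForm l _ hl1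
  have hdeg1 : (fastData r c A F 1).totalDegree = 1 := by rw [hA1, totalDegree_X]
  have hAh : ∀ j, fastData r c A F j ≠ 0 := by
    refine Fin.forall_fin_two.2 ⟨?_, ?_⟩
    · intro h
      have := hdeg0
      rw [h, totalDegree_zero] at this
      exact zero_ne_one this
    · rw [hA1]; exact X_ne_zero 1
  have hd0 : 0 < (fastData r c A F 0).totalDegree := by rw [hdeg0]; exact one_pos
  have hνeq : (((fastData r c A F 0).totalDegree : ℝ) / ((F 0).natDegree + 1) -
      ∑ i : Fin 1, r i.succ * (fastData r c A F i.succ).totalDegree) / r 0 =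
      ((1 : ℝ) / (F₀.natDegree + 1) - r₁) / r₀ := by
    rw [Fin.sum_univ_one, show (Fin.succ (0 : Fin 1) : Fin 2) = 1 from rfl, hdeg0, hdeg1, hF0, hr0, hr1]
    simp
  have hν' : (((fastData r c A F 0).totalDegree : ℝ) / ((F 0).natDegree + 1) -
      ∑ i : Fin 1, r i.succ * (fastData r c A F i.succ).totalDegree) / r 0 <
      (fastData r c A F 0).totalDegree := by
    rw [hνeq, hdeg0]; simpa using hν
  have hfast : ∀ i : Fin 1, F i.succ ≠ 0 →
      ((fastData r c A F 0).totalDegree : ℝ) * ((F i.succ).natDegree + 1) <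
        ((F 0).natDegree + 1) * (fastData r c A F i.succ).totalDegree := by
    intro i hFi
    rw [Fin.fin_one_eq_zero i, show (Fin.succ (0 : Fin 1) : Fin 2) = 1 from rfl, hdeg0, hdeg1, hF0, hF1]
    rw [Fin.fin_one_eq_zero i, show (Fin.succ (0 : Fin 1) : Fin 2) = 1 from rfl, hF1] at hFi
    rcases hdeg with h | h
    · exact absurd h hFi
    · push_cast
      have : (F₁.natDegree : ℝ) < F₀.natDegree := by exact_mod_cast h
      linarith
  have hirr' : Irrational ((((fastData r c A F 0).totalDegree : ℝ) / ((F 0).natDegree + 1) -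
      ∑ i : Fin 1, r i.succ * (fastData r c A F i.succ).totalDegree) / r 0) := by
    rw [hνeq]; exact hirr
  exact unprojectedDense_polyFibredGraph_hyperplane_mixed r hr₀ c A F hF₀ hAh hd0 hν' hfast hirr'

/-- **The certified member `W₂₃ = {x₂ = √2x₀ + √3x₁, y₀ = x₀ + y₂², y₁ = x₁ + y₂}` of `EC(3,2)`
(`sqrtTwoSqrtThreeMixed`, `sqrt_two_sqrt_three_mixed_member_solved`) has ZARISKI DENSE exponential
points** (`ν = (1/2 - √3)/√2` irrational). (new)
[cite: MantovaMasser2023, §1 p.5 (the open case dim π(V) = 2 in ℂ³×ℂˣ³)] -/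
theorem unprojectedDense_sqrtTwoSqrtThreeMixed : UnprojectedDense sqrtTwoSqrtThreeMixed := by
  have h2 : 0 < Real.sqrt 2 := Real.sqrt_pos.2 (by norm_num)
  have h3 : 0 < Real.sqrt 3 := Real.sqrt_pos.2 (by norm_num)
  have hνeq : ((1 : ℝ) / ((Polynomial.X : Polynomial ℂ).natDegree + 1) - Real.sqrt 3) / Real.sqrt 2 =
      ((1 : ℝ) / 2 - Real.sqrt 3) / Real.sqrt 2 := by
    rw [Polynomial.natDegree_X]; norm_num
  have hν : ((1 : ℝ) / ((Polynomial.X : Polynomial ℂ).natDegree + 1) - Real.sqrt 3) / Real.sqrt 2 < 1 := by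
    rw [hνeq, div_lt_one h2]
    have : (1 : ℝ) < Real.sqrt 3 := by
      rw [show (1 : ℝ) = Real.sqrt 1 by simp]
      exact Real.sqrt_lt_sqrt (by norm_num) (by norm_num)
    linarith
  have hirr : Irrational (((1 : ℝ) / ((Polynomial.X : Polynomial ℂ).natDegree + 1) - Real.sqrt 3) /
      Real.sqrt 2) := by
    rw [hνeq]; exact irrational_half_sub_sqrt_three_div_sqrt_two
  have h := unprojectedDense_mixed_diag h2.ne' h3.ne' 0 Polynomial.X_ne_zero (Polynomial.C 1)
    (Or.inr (by rw [Polynomial.natDegree_C, Polynomial.natDegree_X]; exact one_pos)) hν hirr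
  have h' : UnprojectedDense (polyFibredGraph (hyperplanePoly ![Real.sqrt 2, Real.sqrt 3] 0)
      (fun j => X j) ![X 0, 1]) := by
    convert h using 3 with j
    fin_cases j <;> simp
  exact h'

/-- **Summary for `W₂₃`**: all seven hypotheses of `ECCell 3 2`, not linearly split, exponential
points non-empty AND Zariski dense. (new)
[cite: MantovaMasser2023, §1 p.5 (the open case dim π(V) = 2 in ℂ³×ℂˣ³)] -/
theorem sqrtTwoSqrtThreeMixed_member_dense :
    (IsIrreducibleClosed ℂ sqrtTwoSqrtThreeMixed ∧
      (sqrtTwoSqrtThreeMixed ∩ torusLocus ℂ 3).Nonempty ∧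
      IsRotund ℂ 3 (sqrtTwoSqrtThreeMixed ∩ torusLocus ℂ 3) ∧
      IsAddFree ℂ 3 (sqrtTwoSqrtThreeMixed ∩ torusLocus ℂ 3) ∧
      IsMulFree ℂ 3 (sqrtTwoSqrtThreeMixed ∩ torusLocus ℂ 3) ∧
      zariskiDim ℂ sqrtTwoSqrtThreeMixed = (3 : ℕ) ∧
      addProjDim ℂ 3 sqrtTwoSqrtThreeMixed = (2 : ℕ)) ∧
    ¬ IsLinearSplit ℂ 3 sqrtTwoSqrtThreeMixed ∧
    (sqrtTwoSqrtThreeMixed ∩ expGraph ℂ 3).Nonempty ∧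
    UnprojectedDense sqrtTwoSqrtThreeMixed :=
  ⟨sqrt_two_sqrt_three_mixed_member_solved.1, sqrt_two_sqrt_three_mixed_member_solved.2.1,
    sqrt_two_sqrt_three_mixed_member_solved.2.2, unprojectedDense_sqrtTwoSqrtThreeMixed⟩

end Diag

end Summit.Schanuel.Schanuel.Theorems

end
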